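import Summits.QuantumFields.BalabanUV.Beta.GAN24.Push4Nest
import Summits.QuantumFields.BalabanUV.Beta.GAN24.Push4Sym
import Summits.QuantumFields.BalabanUV.Beta.GAN24.AffineUnroll

/-!
# `BalabanUV.Beta.GAN24.Push4Iter` — binder row G-an2-4 / (CONV-C), W-slot road «W3» (SKELETON-W3 v1.0 §8.3 (F1) ↔ §8.6 (F3)): THE k-FOLD TRANSPORT OF THE
# SYMMETRISED PUSH IS ONE SYMMETRISED PUSH THROUGH THE LEG CHAINS —
# `transport (fun j Y ↦ symB (push₄ (l j) (r j) Y)) m (k+1) X = symB (push₄ (legChain l m k) (legChain r m k) X)`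

NOT IN PRINT; OUR PROOF ATTEMPT (G-an2-4 formalisation swarm, leaf prover `b2b-balaban-gan24-formalise-leaf-17`, gen 14; names PROVISIONAL — the row owner
gan24-p1 may rename / re-cut).  HONEST FRAMING (cell contract, verbatim): «discharging `BetaPertH` makes Bałaban's UV stability UNCONDITIONAL — a real
constructive-QFT result; it is NOT the continuum limit and NOT the Clay problem.»  HONEST DEPENDENCY (verbatim): «continuum YM on T⁴ ⇐ BetaPertH ∧ nine
spine estimates (0/9 proved); BetaPertH ⇐ (D1) ∧ (D4) ∧ CAP+tail; G-an2-4 gates asym, D1 and NE2/3/4.»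

WHAT.  The (F1) rows of record unroll the normalised recursion through leaf-01's `AffineUnroll.transport (fun j ↦ lin4 c K♮_j Lc) m k` (p211131), and
`lin4 c K N = −c • (symmetrised sandwich read)` = `−c •` the BOND-SYMMETRISED four-leg push (`Push4Sym.mmRead_sandwich_vsym_eq_push₄`; the scalar comes out by
`AffineUnroll.transport_smul_eq`).  This module closes the algebra between (F1) and the (F3) core (leaf-03's `Push4Locality.push₄_locStencil₂`, stated for ONE
`push₄` with composite legs): for leg families `l j`, `r j` localised at positive rates at blocking `N` and a `LocStencil₂` table `X`,
**`transport_symPush : transport (fun j Y ↦ symB (push₄ (l j) (r j) Y)) m (k + 1) X = symB (push₄ (legChain l m k) (legChain r m k) X)`**, where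
`symB Y μ y ν y′ := ½ • (Y μ y ν y′ + Y ν y′ μ y)` is the bond symmetrisation and `legChain l m k` the `legComp`-chain of the legs of levels `m, …, m+k`
(composite blocking `N^(k+1)`; `Push4Nest.push₄_push₄` at each step).  Ingredients: `push₄_symB` (the push COMMUTES with the bond symmetrisation — `Push4Sym.push₄_swap`
+ linearity), `symB_symB` (idempotence), `locStencil₂_swapT` / `locStencil₂_symB` / `legDecay_legChain` (the hypotheses propagate along the chain; every rate and
constant EXISTENTIAL — the identity itself is rate-free).
[folklore]; 0 cited facts, 0 `Prop` mirrors, 0 sorry; two plumbing definitions (`symB`, `legChain`).  Asserts NO shape of Bałaban's tables; «T2Shape» / «T2SupRate»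
LOCATED / OPEN, NOT IN PRINT; moves no row by itself; discharges NOTHING of (hW, hWall); 0 wall binders instantiated; NOT «W-slot closed», NEVER «G-an2-4 closed»;
NOT BetaPertH, NOT continuum, NOT Clay.
-/

noncomputable section

open Finset
open scoped BigOperators
open Literature.MathematicalPhysics.QuantumFieldTheory
open Literature.MathematicalPhysics.QuantumFieldTheory.Balaban1983to89
open Literature.MathematicalPhysics.QuantumFieldTheory.Balaban1983to89.Beta
open B12Sec2to5 (l1 l1_nonneg)
open ExpKernelCalculus (MKer Decays BiLoc comp Zl Zl_nonneg l1_sub_triangle l1_sub_symm summable_exp_shift summable_exp_shift')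
open OneStepResolventKernel (Fib wsum LocStencil biLoc_mono)
open KKTFluctuationEnergy (summable_mul_of_bdd summable_mul_of_bdd')
open BalabanCompositeJets (LocStencil₂ summable_slice_of_locStencil₂)
open Summit.QuantumFields.BalabanUV.Beta.GAN24.Push4 (legComp vertexW vertexW_apply vertex2W Lk Rk ffRead push₄ push₄_def)
open Summit.QuantumFields.BalabanUV.Beta.GAN24.Push4Bounds (LegDecay LegDecay.nonneg LegDecay.abs_le LegDecay.summable)
open Summit.QuantumFields.BalabanUV.Beta.GAN24.Push4LocStencil (locStencil₂_push₄ cPush)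
open Summit.QuantumFields.BalabanUV.Beta.GAN24.Push4NestAux (summable_vertexW_slice decays_vertex2W_of_bdd abs_le_of_decays abs_comp_Lk_le_of_decays
  summable_Lk_row summable_Rk_col legDecay_legComp)
open Summit.QuantumFields.BalabanUV.Beta.GAN24.Push4Nest (push₄_push₄)
open Summit.QuantumFields.BalabanUV.Beta.GAN24.Push4Sym (comp_left_lin comp_right_lin ffRead_lin push₄_swap)
open Summit.QuantumFields.BalabanUV.Beta.GAN24.AffineUnroll (transport transport_succ transport_zero)

namespace Summit.QuantumFields.BalabanUV.Beta.GAN24.Push4Iter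

variable {d : ℕ}

/-- The type of bi-stencil tables (abbreviation for readability inside this module). -/
abbrev BiTab (d : ℕ) : Type := Fin (d + 1) → (Fin (d + 1) → ℤ) → Fin (d + 1) → (Fin (d + 1) → ℤ) → MKer (d + 1) (Fib d)

/-- The type of leg families. -/
abbrev LegFam (d : ℕ) : Type := Fin (d + 1) → (Fin (d + 1) → ℤ) → Fin (d + 1) → (Fin (d + 1) → ℤ) → ℝ

/-! ## §1 Bond symmetrisation and the leg chains -/

/-- [folklore] **BOND SYMMETRISATION** of a bi-table: `symB Y μ y ν y′ := ½ • (Y μ y ν y′ + Y ν y′ μ y)` (the `vsym`/`W2SymOfK` symmetrisation, written on tables). -/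
def symB (Y : BiTab d) : BiTab d := fun μ y ν y' => (1 / 2 : ℝ) • (Y μ y ν y' + Y ν y' μ y)

/-- [folklore] **THE LEG CHAIN** of levels `m, …, m+k` of a sequence of leg families: `legChain l m 0 = l m`, `legChain l m (k+1) = legComp (legChain l m k) (l (m+k+1))`
(inner = the chain so far, outer = the next level — the orientation of `Push4Nest.push₄_push₄`). -/
def legChain (l : ℕ → LegFam d) (m : ℕ) : ℕ → LegFam d
  | 0 => l m
  | k + 1 => legComp (legChain l m k) (l (m + k + 1))

/-- [folklore] `symB`, pointwise. -/
@[simp] theorem symB_apply (Y : BiTab d) (μ : Fin (d + 1)) (y : Fin (d + 1) → ℤ) (ν : Fin (d + 1)) (y' : Fin (d + 1) → ℤ) :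
    symB Y μ y ν y' = (1 / 2 : ℝ) • (Y μ y ν y' + Y ν y' μ y) := rfl

/-- [folklore] `legChain`, base. -/
@[simp] theorem legChain_zero (l : ℕ → LegFam d) (m : ℕ) : legChain l m 0 = l m := rfl

/-- [folklore] `legChain`, step. -/
@[simp] theorem legChain_succ (l : ℕ → LegFam d) (m k : ℕ) : legChain l m (k + 1) = legComp (legChain l m k) (l (m + k + 1)) := rfl

/-- [folklore] **IDEMPOTENCE**: `symB (symB Y) = symB Y`. -/
theorem symB_symB (Y : BiTab d) : symB (symB Y) = symB Y := by
  funext μ y ν y' x z a b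
  simp only [symB_apply, Pi.smul_apply, Pi.add_apply, smul_eq_mul]
  ring

/-! ## §2 The hypotheses propagate: swapped / symmetrised tables and leg chains stay in their classes -/

/-- [folklore] **THE BOND-SWAPPED TABLE IS A `LocStencil₂` FAMILY** at a third of the rate: `LocStencil₂ Y C δ → LocStencil₂ (fun κ u κ′ u′ ↦ Y κ′ u′ κ u) C (δ/3)`
(re-centring both kernel legs from the second bond to the first costs `2·(δ/3)·|u′−u|`, paid by the far factor). -/
theorem locStencil₂_swapT {Y : BiTab d} {C δ : ℝ} (hY : LocStencil₂ Y C δ) (hδ : 0 ≤ δ) :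
    LocStencil₂ (fun κ u κ' u' => Y κ' u' κ u) C (δ / 3) := by
  have hC := hY.nonneg
  intro κ u κ' u' x z a b
  refine (hY κ' u' κ u x z a b).trans ?_
  rw [mul_assoc, mul_assoc]
  refine mul_le_mul_of_nonneg_left ?_ hC
  rw [← Real.exp_add, ← Real.exp_add, Real.exp_le_exp]
  have tx := l1_sub_triangle x u' u
  have tz := l1_sub_triangle z u' u
  rw [l1_sub_symm u' u] at tx tz
  have e : l1 (u - u') = l1 (u' - u) := l1_sub_symm u u'
  rw [e] at tx tz
  nlinarith [l1_nonneg (x - u'), l1_nonneg (z - u'), l1_nonneg (u' - u), l1_nonneg (x - u), l1_nonneg (z - u)]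

/-- [folklore] `LocStencil₂` is stable under the table operations `s • (Y₁ + Y₂)` (common rate, constants add). -/
theorem locStencil₂_lin {Y₁ Y₂ : BiTab d} {C₁ C₂ δ : ℝ} (h₁ : LocStencil₂ Y₁ C₁ δ) (h₂ : LocStencil₂ Y₂ C₂ δ) (s : ℝ) :
    LocStencil₂ (s • (Y₁ + Y₂)) (|s| * (C₁ + C₂)) δ := by
  intro κ u κ' u' x z a b
  simp only [Pi.smul_apply, Pi.add_apply, smul_eq_mul]
  rw [abs_mul]
  have := h₁ κ u κ' u' x z a b
  have := h₂ κ u κ' u' x z a b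
  calc |s| * |Y₁ κ u κ' u' x z a b + Y₂ κ u κ' u' x z a b|
      ≤ |s| * (|Y₁ κ u κ' u' x z a b| + |Y₂ κ u κ' u' x z a b|) := mul_le_mul_of_nonneg_left (abs_add_le _ _) (abs_nonneg _)
    _ ≤ |s| * (C₁ * Real.exp (-δ * l1 (u' - u)) * Real.exp (-δ * (l1 (x - u) + l1 (z - u)))
          + C₂ * Real.exp (-δ * l1 (u' - u)) * Real.exp (-δ * (l1 (x - u) + l1 (z - u)))) := by
        refine mul_le_mul_of_nonneg_left (add_le_add ‹_› ‹_›) (abs_nonneg _)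
    _ = _ := by ring

/-- [folklore] **THE SYMMETRISED TABLE IS A `LocStencil₂` FAMILY** (rate `δ/3`, constant `C`). -/
theorem locStencil₂_symB {Y : BiTab d} {C δ : ℝ} (hY : LocStencil₂ Y C δ) (hδ : 0 ≤ δ) : LocStencil₂ (symB Y) C (δ / 3) := by
  have hC := hY.nonneg
  have h₁ : LocStencil₂ Y C (δ / 3) := hY.mono (by linarith)
  have h₂ := locStencil₂_swapT hY hδ
  have h := locStencil₂_lin h₁ h₂ (1 / 2 : ℝ)
  have e : |(1 / 2 : ℝ)| * (C + C) = C := by rw [abs_of_pos (by norm_num : (0 : ℝ) < 1 / 2)]; ring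
  rw [e] at h
  exact h

/-- [folklore] **LEG CHAINS ARE LOCALISED**: if every level's legs are localised at a positive rate at blocking `N ≥ 1`, the chain of levels `m … m+k` is localised at a
positive rate at blocking `N^(k+1)` (induction on `k` with `Push4NestAux.legDecay_legComp`; constants and rates existential). -/
theorem legDecay_legChain {l : ℕ → LegFam d} {N : ℕ} (hl : ∀ j, ∃ C m : ℝ, 0 < m ∧ LegDecay (l j) N C m) (m₀ : ℕ) :
    ∀ k, ∃ C m : ℝ, 0 < m ∧ LegDecay (legChain l m₀ k) (N ^ (k + 1)) C m
  | 0 => by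
    obtain ⟨C, m, hm, h⟩ := hl m₀
    exact ⟨C, m, hm, by simpa [legChain_zero, pow_one] using h⟩
  | k + 1 => by
    obtain ⟨C₂, m₂, hm₂, h₂⟩ := legDecay_legChain hl m₀ k
    obtain ⟨C₁, m₁, hm₁, h₁⟩ := hl (m₀ + k + 1)
    -- a composite rate `m'` with `m' ≤ m₂` and `m' · N^(k+1) < m₁`
    obtain ⟨m', hm'0, hm'₂, hm'₁⟩ : ∃ m' : ℝ, 0 < m' ∧ m' ≤ m₂ ∧ m' * (N ^ (k + 1) : ℕ) < m₁ := by
      refine ⟨min m₂ (m₁ / (2 * (((N ^ (k + 1) : ℕ) : ℝ) + 1))), lt_min hm₂ (by positivity), min_le_left _ _, ?_⟩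
      have hN : (0 : ℝ) ≤ ((N ^ (k + 1) : ℕ) : ℝ) := Nat.cast_nonneg _
      have hpos : (0 : ℝ) < 2 * (((N ^ (k + 1) : ℕ) : ℝ) + 1) := by positivity
      have h1 : min m₂ (m₁ / (2 * (((N ^ (k + 1) : ℕ) : ℝ) + 1))) * ((N ^ (k + 1) : ℕ) : ℝ)
          ≤ m₁ / (2 * (((N ^ (k + 1) : ℕ) : ℝ) + 1)) * ((N ^ (k + 1) : ℕ) : ℝ) := mul_le_mul_of_nonneg_right (min_le_right _ _) hN
      have h2 : m₁ / (2 * (((N ^ (k + 1) : ℕ) : ℝ) + 1)) * ((N ^ (k + 1) : ℕ) : ℝ) < m₁ := by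
        calc m₁ / (2 * (((N ^ (k + 1) : ℕ) : ℝ) + 1)) * ((N ^ (k + 1) : ℕ) : ℝ)
            < m₁ / (2 * (((N ^ (k + 1) : ℕ) : ℝ) + 1)) * (2 * (((N ^ (k + 1) : ℕ) : ℝ) + 1)) :=
              mul_lt_mul_of_pos_left (by linarith) (div_pos hm₁ hpos)
          _ = m₁ := div_mul_cancel₀ _ hpos.ne'
      exact h1.trans_lt h2
    refine ⟨(d + 1 : ℕ) * (C₁ * C₂ * Zl (d + 1) (m₁ - m' * ((N ^ (k + 1) : ℕ) : ℝ))), m', hm'0, ?_⟩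
    rw [legChain_succ, pow_succ]
    exact legDecay_legComp h₁ h₂ hm'0.le hm'₂ hm'₁

/-! ## §3 The push commutes with the bond symmetrisation -/

/-- [folklore] Linearity of the second-order vertex in the TABLE (bounded legs, tables with summable slices in both bond positions):
`vertex2W r (s • (Y₁ + Y₂)) μ y ν y′ = s • (vertex2W r Y₁ μ y ν y′ + vertex2W r Y₂ μ y ν y′)`. -/
theorem vertex2W_lin {r : LegFam d} {Cr : ℝ} (hr : ∀ μ y κ u, |r μ y κ u| ≤ Cr) (hCr : 0 ≤ Cr) {Y₁ Y₂ : BiTab d} {C₁ C₂ δ : ℝ}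
    (h₁ : LocStencil₂ Y₁ C₁ δ) (h₂ : LocStencil₂ Y₂ C₂ δ) (hδ : 0 < δ) (s : ℝ) (μ : Fin (d + 1)) (y : Fin (d + 1) → ℤ) (ν : Fin (d + 1))
    (y' : Fin (d + 1) → ℤ) : vertex2W r (s • (Y₁ + Y₂)) μ y ν y' = s • (vertex2W r Y₁ μ y ν y' + vertex2W r Y₂ μ y ν y') := by
  funext x z a b
  simp only [vertex2W, vertexW_apply, Pi.smul_apply, Pi.add_apply, smul_eq_mul]
  -- inner slices are summable, so the inner vertex is linear
  have hin : ∀ κ u, (∑ κ', ∑' u', r ν y' κ' u' * (s * (Y₁ κ u κ' u' x z a b + Y₂ κ u κ' u' x z a b)))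
      = s * ((∑ κ', ∑' u', r ν y' κ' u' * Y₁ κ u κ' u' x z a b) + ∑ κ', ∑' u', r ν y' κ' u' * Y₂ κ u κ' u' x z a b) := by
    intro κ u
    rw [mul_add, Finset.mul_sum, Finset.mul_sum, ← Finset.sum_add_distrib]
    refine Finset.sum_congr rfl fun κ' _ => ?_
    have hs₁ : Summable fun u' => r ν y' κ' u' * Y₁ κ u κ' u' x z a b :=
      summable_mul_of_bdd (fun u' => hr ν y' κ' u') (summable_slice_of_locStencil₂ h₁ hδ κ u κ' x z a b)
    have hs₂ : Summable fun u' => r ν y' κ' u' * Y₂ κ u κ' u' x z a b :=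
      summable_mul_of_bdd (fun u' => hr ν y' κ' u') (summable_slice_of_locStencil₂ h₂ hδ κ u κ' x z a b)
    rw [← tsum_mul_left, ← tsum_mul_left, ← hs₁.mul_left s |>.tsum_add (hs₂.mul_left s)]
    exact tsum_congr fun u' => by ring
  simp only [hin]
  -- outer: the slices of the two inner vertices are summable in the first bond position
  rw [mul_add, Finset.mul_sum, Finset.mul_sum, ← Finset.sum_add_distrib]
  refine Finset.sum_congr rfl fun κ _ => ?_
  have hs₁ : Summable fun u => r μ y κ u * ∑ κ', ∑' u', r ν y' κ' u' * Y₁ κ u κ' u' x z a b := by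
    have h := summable_vertexW_slice hr hCr h₁ hδ κ ν y' x z a b
    simp only [vertexW_apply] at h
    exact summable_mul_of_bdd (fun u => hr μ y κ u) h
  have hs₂ : Summable fun u => r μ y κ u * ∑ κ', ∑' u', r ν y' κ' u' * Y₂ κ u κ' u' x z a b := by
    have h := summable_vertexW_slice hr hCr h₂ hδ κ ν y' x z a b
    simp only [vertexW_apply] at h
    exact summable_mul_of_bdd (fun u => hr μ y κ u) h
  rw [← tsum_mul_left, ← tsum_mul_left, ← hs₁.mul_left s |>.tsum_add (hs₂.mul_left s)]
  exact tsum_congr fun u => by ring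

/-- [folklore] **LINEARITY OF THE PUSH IN THE TABLE** (legs localised at a positive rate, tables `LocStencil₂` at a positive rate):
`push₄ l r (s • (Y₁ + Y₂)) μ y ν y′ = s • (push₄ l r Y₁ μ y ν y′ + push₄ l r Y₂ μ y ν y′)`. -/
theorem push₄_lin {l r : LegFam d} {N : ℕ} {Cl Cr m : ℝ} (hl : LegDecay l N Cl m) (hr : LegDecay r N Cr m) (hm : 0 < m) {Y₁ Y₂ : BiTab d}
    {C₁ C₂ δ : ℝ} (h₁ : LocStencil₂ Y₁ C₁ δ) (h₂ : LocStencil₂ Y₂ C₂ δ) (hδ : 0 < δ) (s : ℝ) (μ : Fin (d + 1)) (y : Fin (d + 1) → ℤ)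
    (ν : Fin (d + 1)) (y' : Fin (d + 1) → ℤ) :
    push₄ l r (s • (Y₁ + Y₂)) μ y ν y' = s • (push₄ l r Y₁ μ y ν y' + push₄ l r Y₂ μ y ν y') := by
  have hCr := hr.nonneg
  have hCl := hl.nonneg
  have hrb : ∀ μ y κ u, |r μ y κ u| ≤ Cr := fun μ y κ u => hr.abs_le hm.le μ y κ u
  have hlb : ∀ α x' κ x, |l α x' κ x| ≤ Cl := fun α x' κ x => hl.abs_le hm.le α x' κ x
  have hls : ∀ α x' κ, Summable fun x => l α x' κ x := fun α x' κ => hl.summable hm α x' κ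
  have hrs : ∀ β z' κ, Summable fun z => r β z' κ z := fun β z' κ => hr.summable hm β z' κ
  have hd₁ := decays_vertex2W_of_bdd hrb hCr h₁ hδ μ y ν y'
  have hd₂ := decays_vertex2W_of_bdd hrb hCr h₂ hδ μ y ν y'
  rw [push₄_def, push₄_def, push₄_def, vertex2W_lin hrb hCr h₁ h₂ hδ s μ y ν y',
    comp_left_lin (fun x a f => summable_Lk_row hls x a f) (fun w z f b => abs_le_of_decays hd₁ (half_pos hδ).le w z f b)
      (fun w z f b => abs_le_of_decays hd₂ (half_pos hδ).le w z f b),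
    comp_right_lin (fun z f b => summable_Rk_col hrs z f b)
      (fun x w a f => abs_comp_Lk_le_of_decays hlb hCl hd₁ (half_pos hδ) x w a f)
      (fun x w a f => abs_comp_Lk_le_of_decays hlb hCl hd₂ (half_pos hδ) x w a f),
    ffRead_lin]

/-- [folklore] **THE PUSH COMMUTES WITH THE BOND SYMMETRISATION**: `push₄ l r (symB Y) = symB (push₄ l r Y)` (linearity + the swap law `Push4Sym.push₄_swap`). -/
theorem push₄_symB {l r : LegFam d} {N : ℕ} {Cl Cr m : ℝ} (hl : LegDecay l N Cl m) (hr : LegDecay r N Cr m) (hm : 0 < m) {Y : BiTab d} {C δ : ℝ}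
    (hY : LocStencil₂ Y C δ) (hδ : 0 < δ) : push₄ l r (symB Y) = symB (push₄ l r Y) := by
  funext μ y ν y'
  have hY₃ : LocStencil₂ Y C (δ / 3) := hY.mono (by linarith)
  have hYt := locStencil₂_swapT hY hδ.le
  have e : symB Y = (1 / 2 : ℝ) • (Y + fun κ u κ' u' => Y κ' u' κ u) := by
    funext κ u κ' u'; rfl
  rw [e, push₄_lin hl hr hm hY₃ hYt (by positivity) (1 / 2 : ℝ) μ y ν y', push₄_swap hr hm hY hδ ν y' μ y, symB_apply]

/-! ## §4 The k-fold transport of the symmetrised push -/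

/-- [folklore] **THE k-FOLD TRANSPORT OF THE SYMMETRISED PUSH IS ONE SYMMETRISED PUSH THROUGH THE LEG CHAINS.**  For leg families `l j`, `r j` each localised at a
positive rate at blocking `N ≥ 1` and a table `X` in `LocStencil₂` at a positive rate,
`transport (fun j Y ↦ symB (push₄ (l j) (r j) Y)) m (k + 1) X = symB (push₄ (legChain l m k) (legChain r m k) X)`
(`Push4Nest.push₄_push₄` at every step, the symmetrisation pulled through by `push₄_symB` and absorbed by `symB_symB`).  With `Push4Sym.mmRead_sandwich_vsym_eq_push₄`
(`lin4 c K N = −c • symB ∘ push₄ (rowM K N) (colH K N)` on ff-valued `LocStencil₂` tables) and `AffineUnroll.transport_smul_eq` this is the (F1)→(F3) flattening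
`transport (fun j ↦ lin4 c K♮_j Lc) m (k+1) X = (−c)^(k+1) • symB (push₄ (legChain (rowM K♮_· Lc) m k) (legChain (colH K♮_· Lc) m k) X)`. -/
theorem transport_symPush {l r : ℕ → LegFam d} {N : ℕ} (hN : 1 ≤ N) (hl : ∀ j, ∃ C m : ℝ, 0 < m ∧ LegDecay (l j) N C m)
    (hr : ∀ j, ∃ C m : ℝ, 0 < m ∧ LegDecay (r j) N C m) {X : BiTab d} (hX : ∃ C δ : ℝ, 0 < δ ∧ LocStencil₂ X C δ) (m : ℕ) :
    ∀ k, transport (fun j Y => symB (push₄ (l j) (r j) Y)) m (k + 1) X = symB (push₄ (legChain l m k) (legChain r m k) X)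
  | 0 => by simp [transport_succ, transport_zero, legChain_zero]
  | k + 1 => by
    rw [transport_succ, transport_symPush hN hl hr hX m k, legChain_succ, legChain_succ,
      show m + (k + 1) = m + k + 1 from (Nat.add_assoc m k 1).symm]
    -- data at the outer level `m + k + 1` and for the chains
    obtain ⟨Cl₁, ml₁, hml₁, hl₁⟩ := hl (m + k + 1)
    obtain ⟨Cr₁, mr₁, hmr₁, hr₁⟩ := hr (m + k + 1)
    obtain ⟨CL, mL, hmL, hL⟩ := legDecay_legChain hl m k
    obtain ⟨CR, mR, hmR, hR⟩ := legDecay_legChain hr m k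
    obtain ⟨C, δ, hδ, hXl⟩ := hX
    -- common rates (weaken to the minimum)
    have hl₁' : LegDecay (l (m + k + 1)) N Cl₁ (min ml₁ mr₁) := fun α x' κ x =>
      (hl₁ α x' κ x).trans (mul_le_mul_of_nonneg_left (Real.exp_le_exp.2 (by nlinarith [min_le_left ml₁ mr₁, l1_nonneg (x - (N : ℤ) • x')])) hl₁.nonneg)
    have hr₁' : LegDecay (r (m + k + 1)) N Cr₁ (min ml₁ mr₁) := fun β z' κ z =>
      (hr₁ β z' κ z).trans (mul_le_mul_of_nonneg_left (Real.exp_le_exp.2 (by nlinarith [min_le_right ml₁ mr₁, l1_nonneg (z - (N : ℤ) • z')])) hr₁.nonneg)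
    have hL' : LegDecay (legChain l m k) (N ^ (k + 1)) CL (min mL mR) := fun α x' κ x =>
      (hL α x' κ x).trans (mul_le_mul_of_nonneg_left (Real.exp_le_exp.2 (by nlinarith [min_le_left mL mR, l1_nonneg (x - ((N ^ (k + 1) : ℕ) : ℤ) • x')])) hL.nonneg)
    have hR' : LegDecay (legChain r m k) (N ^ (k + 1)) CR (min mL mR) := fun β z' κ z =>
      (hR β z' κ z).trans (mul_le_mul_of_nonneg_left (Real.exp_le_exp.2 (by nlinarith [min_le_right mL mR, l1_nonneg (z - ((N ^ (k + 1) : ℕ) : ℤ) • z')])) hR.nonneg)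
    have hm₁ : 0 < min ml₁ mr₁ := lt_min hml₁ hmr₁
    have hm₂ : 0 < min mL mR := lt_min hmL hmR
    -- the inner push is a `LocStencil₂` table at a positive rate (Push4LocStencil, rate kept and dilated)
    obtain ⟨δ', hδ'0, hδ'δ, hδ'm⟩ : ∃ δ' : ℝ, 0 < δ' ∧ δ' ≤ δ ∧ 3 * δ' < min mL mR := by
      refine ⟨min δ (min mL mR / 4), lt_min hδ (by positivity), min_le_left _ _, ?_⟩
      have := min_le_right δ (min mL mR / 4); linarith
    have hY : LocStencil₂ (push₄ (legChain l m k) (legChain r m k) X) (cPush d CL CR (min mL mR) δ' * C) (((N ^ (k + 1) : ℕ) : ℝ) * δ') :=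
      locStencil₂_push₄ hL' hR' (hXl.mono hδ'δ) hδ'0.le hδ'm
    have hNpos : (0 : ℝ) < ((N ^ (k + 1) : ℕ) : ℝ) := by exact_mod_cast pow_pos hN k.succ
    have hYrate : 0 < ((N ^ (k + 1) : ℕ) : ℝ) * δ' := mul_pos hNpos hδ'0
    -- pull the symmetrisation through the outer push, absorb it, and nest
    rw [push₄_symB hl₁' hr₁' hm₁ hY hYrate, symB_symB]
    congr 1
    funext μ y ν y'
    exact push₄_push₄ hl₁' hr₁' hL' hR' hm₁ hm₂ hXl hδ μ y ν y'

end Summit.QuantumFields.BalabanUV.Beta.GAN24.Push4Iter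

end
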